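import Mathlib.MeasureTheory.Function.Jacobian
import Summits.FinalStateConjecture.FinalStateConjecture.Theorems.EIHFluxBalanceModulatedKerrHandoffFarConeStretch
import Summits.FinalStateConjecture.FinalStateConjecture.Theorems.EIHFluxBalanceModulatedKerrHandoffFarConeField
import Summits.FinalStateConjecture.FinalStateConjecture.Theorems.EIHFluxBalanceModulatedKerrHandoffFarConeGreen

/-!
# Far-cone retardation remainder, VIII: the travelling profile is the retarded integral of the tangent motion

Support file 8 for the brick `SoftEraTubeLift.FarConeRetardationRemainder` of crux
`EIHFluxBalance.ModulatedKerrHandoff` (H′, stmt-FinalStateConjecture-17402; card `soft-era-tube-lift`).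
A `C²` profile `W → 0` at infinity with `D²W[v₀, v₀] − ΔW = 4πM φ` (`‖v₀‖ < 1`, `φ` continuous,
supported in the unit ball) is, at every point `r`, the RETARDED INTEGRAL of the bump carried by
the uniform motion with velocity `v₀` through the origin:
`W(r) = M ∫ φ(y + ‖y − r‖ v₀)/‖y − r‖ dy` (`travelling_profile_eq_retarded_integral`).
Steps: the stretch `T` of file V makes `W ∘ T` a decaying `C²` function with Laplacian
`−4πM φ ∘ T`, hence (file VII) the Newtonian potential `M ∫ φ(Ty)/‖z − y‖ dy`; the linear change
of variables `y = S y′` (`S = T⁻¹`, `det S = 1/γ`, `γ‖S q‖ = ρ(q) = √((1−‖v₀‖²)‖q‖² + ⟪v₀, q⟫²)`)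
gives the present-position Liénard–Wiechert form `W(r) = M ∫ φ(y)/ρ(r − y) dy`; the retarded
change of variables `y ↦ y + ‖y − r‖ v₀` (a bijection of `ℝ³ ∖ {r}`, Jacobian `1 + ⟪m, v₀⟫`,
`ρ(r − y − ‖y − r‖v₀) = ‖y − r‖(1 + ⟪m, v₀⟫)`, `m = (y − r)/‖y − r‖`) gives the retarded form
(Mathlib `integral_image_eq_integral_abs_det_fderiv_smul`, twice).  [folklore; Liénard 1898,
Wiechert 1900 for the physics]
-/

noncomputable section

open MeasureTheory Set Filter Topology Metric InnerProductSpace Literature.Geometry.Lorentzian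
open Literature.Analysis.FluidPDE
open scoped RealInnerProductSpace Laplacian

-- the doubled `FinalStateConjecture` path component is the summit/problem naming scheme
set_option linter.dupNamespace false

namespace Summit.FinalStateConjecture.FinalStateConjecture.Theorems.EIHFluxBalance.ModulatedKerrHandoffBricks.FarCone

variable {W φ : E3 → ℝ} {v₀ : E3} {M : ℝ}

/-! ### The stretch as a continuous linear equivalence -/

/-- Determinant of the inverse stretch `S = I + ((1+γ)γ)⁻¹ v₀ ⊗ v₀`: `det S = γ⁻¹`. [folklore] -/
theorem det_unstretch (hv : ‖v₀‖ < 1) :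
    (ContinuousLinearMap.id ℝ E3 + ((1 + Real.sqrt (1 - ‖v₀‖ ^ 2))⁻¹ *
        (Real.sqrt (1 - ‖v₀‖ ^ 2))⁻¹) • (innerSL ℝ v₀).smulRight v₀).det =
      (Real.sqrt (1 - ‖v₀‖ ^ 2))⁻¹ := by
  have hγ := gamma_pos hv
  have hγ2 := gamma_sq hv
  set γ := Real.sqrt (1 - ‖v₀‖ ^ 2) with hγdef
  have hS : ContinuousLinearMap.id ℝ E3 + ((1 + γ)⁻¹ * γ⁻¹) • (innerSL ℝ v₀).smulRight v₀ =
      ContinuousLinearMap.id ℝ E3 + (innerSL ℝ (((1 + γ)⁻¹ * γ⁻¹) • v₀)).smulRight v₀ := by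
    ext1 z
    simp only [add_apply, ContinuousLinearMap.id_apply, FunLike.coe_smul, Pi.smul_apply,
      ContinuousLinearMap.smulRight_apply, innerSL_apply_apply, real_inner_smul_left, smul_smul]
  rw [hS, det_id_add_smulRight, real_inner_smul_left, real_inner_self_eq_norm_sq,
    show ‖v₀‖ ^ 2 = 1 - γ ^ 2 by linarith [hγ2]]
  have h1 : (1 + γ) ≠ 0 := by positivity
  field_simp
  ring

/-- **`W ∘ T` is the Newtonian potential `M ∫ φ(Ty)/‖z − y‖ dy`** (files V and VII). [folklore] -/
theorem comp_stretch_eq_integral (hW : ContDiff ℝ 2 W) (hW0 : Tendsto W (cocompact E3) (𝓝 0))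
    (hφ0 : ∀ z : E3, 1 ≤ ‖z‖ → φ z = 0) (hv : ‖v₀‖ < 1)
    (hPDE : ∀ z, fderiv ℝ (fun q ↦ fderiv ℝ W q v₀) z v₀ - (Δ W) z = 4 * Real.pi * M * φ z)
    (z : E3) :
    W ((ContinuousLinearMap.id ℝ E3 -
        (1 + Real.sqrt (1 - ‖v₀‖ ^ 2))⁻¹ • (innerSL ℝ v₀).smulRight v₀) z) =
      M * ∫ y, φ ((ContinuousLinearMap.id ℝ E3 -
        (1 + Real.sqrt (1 - ‖v₀‖ ^ 2))⁻¹ • (innerSL ℝ v₀).smulRight v₀) y) / ‖z - y‖ := by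
  set T : E3 →L[ℝ] E3 := ContinuousLinearMap.id ℝ E3 -
    (1 + Real.sqrt (1 - ‖v₀‖ ^ 2))⁻¹ • (innerSL ℝ v₀).smulRight v₀ with hT
  set S : E3 →L[ℝ] E3 := ContinuousLinearMap.id ℝ E3 + ((1 + Real.sqrt (1 - ‖v₀‖ ^ 2))⁻¹ *
    (Real.sqrt (1 - ‖v₀‖ ^ 2))⁻¹) • (innerSL ℝ v₀).smulRight v₀ with hS
  -- `T` as a homeomorphism
  let Te : E3 ≃L[ℝ] E3 := ContinuousLinearEquiv.equivOfInverse T S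
    (fun q ↦ unstretch_apply_stretch hv q) (fun q ↦ stretch_apply_unstretch hv q)
  have hTe : ∀ q, Te q = T q := fun _ ↦ rfl
  -- `W ∘ T` : `C²`, decaying, Laplacian `-4πM φ ∘ T`
  set W₁ : E3 → ℝ := fun q ↦ W (T q) with hW₁
  have hW₁c : ContDiff ℝ 2 W₁ := hW.comp T.contDiff
  have hW₁0 : Tendsto W₁ (cocompact E3) (𝓝 0) := by
    have hT0 : Tendsto (fun q ↦ Te q) (cocompact E3) (cocompact E3) :=
      Te.toHomeomorph.map_cocompact.le
    exact hW0.comp hT0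
  set g : E3 → ℝ := fun q ↦ -(4 * Real.pi * M) * φ (T q) with hg
  have hφc : HasCompactSupport φ := by
    refine HasCompactSupport.intro (isCompact_closedBall (0 : E3) 1) fun z hz ↦ hφ0 z ?_
    rw [mem_closedBall, dist_zero_right, not_le] at hz
    exact hz.le
  have hgc : HasCompactSupport g := by
    have h1 : HasCompactSupport (φ ∘ Te.toHomeomorph) := hφc.comp_homeomorph Te.toHomeomorph
    exact h1.mul_left
  have hΔ : ∀ y, (Δ W₁) y = g y := by
    intro y
    rw [hW₁, laplacian_comp_stretch hW hv y, hg]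
    have := hPDE (T y)
    linarith
  have hGreen : W (T z) = ∫ y, newtonKernel (z - y) * g y :=
    eq_integral_newtonKernel_of_laplacian hW₁c hW₁0 hgc hΔ z
  rw [hGreen, ← integral_const_mul]
  refine integral_congr_ae (Eventually.of_forall fun y ↦ ?_)
  simp only [hg, newtonKernel_eq]
  by_cases hzy : ‖z - y‖ = 0
  · simp [hzy]
  · field_simp

/-- **Present-position (Liénard–Wiechert) form**: `W(r) = M ∫ φ(y)/ρ(r − y) dy` with
`ρ(q) = √((1 − ‖v₀‖²)‖q‖² + ⟪v₀, q⟫²)`. [folklore] -/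
theorem eq_integral_div_lwDist (hW : ContDiff ℝ 2 W) (hW0 : Tendsto W (cocompact E3) (𝓝 0))
    (hφ0 : ∀ z : E3, 1 ≤ ‖z‖ → φ z = 0) (hv : ‖v₀‖ < 1)
    (hPDE : ∀ z, fderiv ℝ (fun q ↦ fderiv ℝ W q v₀) z v₀ - (Δ W) z = 4 * Real.pi * M * φ z)
    (r : E3) :
    W r = M * ∫ y, φ y / Real.sqrt ((1 - ‖v₀‖ ^ 2) * ‖r - y‖ ^ 2 + ⟪v₀, r - y⟫ ^ 2) := by
  have hγ := gamma_pos hv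
  have hγ2 := gamma_sq hv
  set γ := Real.sqrt (1 - ‖v₀‖ ^ 2) with hγdef
  set T : E3 →L[ℝ] E3 := ContinuousLinearMap.id ℝ E3 - (1 + γ)⁻¹ • (innerSL ℝ v₀).smulRight v₀
    with hT
  set S : E3 →L[ℝ] E3 := ContinuousLinearMap.id ℝ E3 + ((1 + γ)⁻¹ * γ⁻¹) •
    (innerSL ℝ v₀).smulRight v₀ with hS
  have hTS : ∀ q, T (S q) = q := fun q ↦ stretch_apply_unstretch hv q
  have hST : ∀ q, S (T q) = q := fun q ↦ unstretch_apply_stretch hv q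
  -- `W r = W (T (S r)) = M ∫ φ(Ty)/‖S r - y‖ dy`
  have h1 : W r = M * ∫ y, φ (T y) / ‖S r - y‖ := by
    have := comp_stretch_eq_integral hW hW0 hφ0 hv hPDE (S r)
    rwa [hTS] at this
  -- linear change of variables `y = S y'`
  have hcv : ∫ y, φ (T y) / ‖S r - y‖ = ∫ y', |S.det| • (φ (T (S y')) / ‖S r - S y'‖) := by
    have himg : S '' univ = univ := by
      refine eq_univ_of_forall fun y ↦ ⟨T y, mem_univ _, hST y⟩
    have hinj : InjOn S univ := fun a _ b _ hab ↦ by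
      have := congrArg T hab
      rwa [hTS, hTS] at this
    have h := integral_image_eq_integral_abs_det_fderiv_smul volume MeasurableSet.univ
      (fun y _ ↦ (S.hasFDerivAt).hasFDerivWithinAt) hinj (fun y ↦ φ (T y) / ‖S r - y‖)
    rwa [himg, Measure.restrict_univ] at h
  rw [h1, hcv]
  congr 1
  refine integral_congr_ae (Eventually.of_forall fun y ↦ ?_)
  simp only
  have hdetS : S.det = γ⁻¹ := by
    rw [hS, hγdef]
    exact det_unstretch hv
  rw [hTS, hdetS, abs_of_pos (inv_pos.2 hγ), smul_eq_mul, ← map_sub]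
  -- `γ⁻¹ / ‖S q‖ = 1 / ρ(q)`
  have hρ : Real.sqrt ((1 - ‖v₀‖ ^ 2) * ‖r - y‖ ^ 2 + ⟪v₀, r - y⟫ ^ 2) = γ * ‖S (r - y)‖ := by
    rw [← gamma_sq_mul_norm_unstretch_sq hv (r - y), ← hγdef, ← mul_pow,
      Real.sqrt_sq (mul_nonneg hγ.le (norm_nonneg _))]
  rw [hρ]
  field_simp

/-! ### The retarded change of variables `y ↦ y + ‖y − r‖ v₀` -/

section Retarded

variable {v₀ r : E3}

/-- The retarded map is injective (`‖v₀‖ < 1`). [folklore] -/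
theorem retardedMap_injective (hv : ‖v₀‖ < 1) :
    Function.Injective fun y : E3 ↦ y + ‖y - r‖ • v₀ := by
  intro a b hab
  have h : a - b = (‖b - r‖ - ‖a - r‖) • v₀ := by
    simp only at hab
    rw [sub_smul]
    linear_combination (norm := module) hab
  have h1 : ‖a - b‖ ≤ ‖a - b‖ * ‖v₀‖ := by
    calc ‖a - b‖ = |‖b - r‖ - ‖a - r‖| * ‖v₀‖ := by rw [h, norm_smul, Real.norm_eq_abs]
      _ ≤ ‖(b - r) - (a - r)‖ * ‖v₀‖ :=
          mul_le_mul_of_nonneg_right (abs_norm_sub_norm_le _ _) (norm_nonneg _)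
      _ = ‖a - b‖ * ‖v₀‖ := by rw [sub_sub_sub_cancel_right, norm_sub_rev]
  have h2 : ‖a - b‖ * (1 - ‖v₀‖) ≤ 0 := by linarith
  have h3 : ‖a - b‖ ≤ 0 := by
    by_contra h4
    push Not at h4
    have := mul_pos h4 (by linarith : 0 < 1 - ‖v₀‖)
    linarith
  exact sub_eq_zero.1 (norm_le_zero_iff.1 h3)

/-- The retarded map is onto `ℝ³ ∖ {r}` from `ℝ³ ∖ {r}`: explicit retarded distance
`σ = (ρ(q) − ⟪q, v₀⟫)/(1 − ‖v₀‖²)`, `q = y′ − r`. [folklore] -/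
theorem retardedMap_image_compl (hv : ‖v₀‖ < 1) :
    (fun y : E3 ↦ y + ‖y - r‖ • v₀) '' {r}ᶜ = {r}ᶜ := by
  have hβ : ‖v₀‖ ^ 2 < 1 := by nlinarith [norm_nonneg v₀]
  refine Subset.antisymm ?_ ?_
  · rintro _ ⟨y, hy, rfl⟩ h
    have hinj := retardedMap_injective (r := r) hv
    have : (fun y : E3 ↦ y + ‖y - r‖ • v₀) y = (fun y : E3 ↦ y + ‖y - r‖ • v₀) r := by
      simp only [sub_self, norm_zero, zero_smul, add_zero]; exact h
    exact hy (hinj this)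
  · intro y' hy'
    set q : E3 := y' - r with hq
    set p : ℝ := ⟪q, v₀⟫ with hp
    set ρ : ℝ := Real.sqrt ((1 - ‖v₀‖ ^ 2) * ‖q‖ ^ 2 + p ^ 2) with hρ
    have hρ0 : 0 ≤ ρ := Real.sqrt_nonneg _
    have hρ2 : ρ ^ 2 = (1 - ‖v₀‖ ^ 2) * ‖q‖ ^ 2 + p ^ 2 :=
      Real.sq_sqrt (by nlinarith [norm_nonneg q])
    have hpρ : |p| ≤ ρ := by
      rw [← Real.sqrt_sq_eq_abs]
      exact Real.sqrt_le_sqrt (by nlinarith [norm_nonneg q])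
    set σ : ℝ := (ρ - p) / (1 - ‖v₀‖ ^ 2) with hσ
    have hσ0 : 0 ≤ σ := div_nonneg (by linarith [le_abs_self p]) (by linarith)
    have h1b : (1 : ℝ) - ‖v₀‖ ^ 2 ≠ 0 := by linarith
    have hσ' : σ * (1 - ‖v₀‖ ^ 2) = ρ - p := by rw [hσ]; field_simp
    have hquad : (1 - ‖v₀‖ ^ 2) * σ ^ 2 + 2 * σ * p - ‖q‖ ^ 2 = 0 := by
      calc (1 - ‖v₀‖ ^ 2) * σ ^ 2 + 2 * σ * p - ‖q‖ ^ 2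
          = σ * (σ * (1 - ‖v₀‖ ^ 2)) + 2 * σ * p - ‖q‖ ^ 2 := by ring
        _ = σ * (ρ + p) - ‖q‖ ^ 2 := by rw [hσ']; ring
        _ = (ρ - p) / (1 - ‖v₀‖ ^ 2) * (ρ + p) - ‖q‖ ^ 2 := by rw [hσ]
        _ = (ρ ^ 2 - p ^ 2) / (1 - ‖v₀‖ ^ 2) - ‖q‖ ^ 2 := by ring
        _ = 0 := by rw [hρ2]; field_simp; ring
    -- the preimage
    refine ⟨y' - σ • v₀, ?_, ?_⟩
    · intro h
      have hσ' : σ = 0 := by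
        have h0 : y' - σ • v₀ - r = q - σ • v₀ := by rw [hq]; abel
        have hnorm : ‖q - σ • v₀‖ ^ 2 = σ ^ 2 := by
          rw [norm_sub_sq_real, real_inner_smul_right, norm_smul, mul_pow, Real.norm_eq_abs, sq_abs,
            ← hp]
          linear_combination (-1 : ℝ) * hquad
        have : q - σ • v₀ = 0 := by rw [← h0, show y' - σ • v₀ = r from h, sub_self]
        rw [this, norm_zero] at hnorm
        nlinarith
      apply hy'
      rw [mem_singleton_iff]
      have : ρ = p := by
        rw [hσ, div_eq_zero_iff] at hσ'
        rcases hσ' with h1 | h1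
        · linarith
        · linarith
      -- then `(1 - β)‖q‖² = 0`, so `q = 0`
      have hq0 : ‖q‖ ^ 2 = 0 := by nlinarith [hρ2]
      have : q = 0 := by simpa using hq0
      rw [hq] at this
      exact sub_eq_zero.1 this
    · simp only
      have h0 : y' - σ • v₀ - r = q - σ • v₀ := by rw [hq]; abel
      have hnorm : ‖q - σ • v₀‖ = σ := by
        have h2 : ‖q - σ • v₀‖ ^ 2 = σ ^ 2 := by
          rw [norm_sub_sq_real, real_inner_smul_right, norm_smul, mul_pow, Real.norm_eq_abs, sq_abs,
            ← hp]
          linear_combination (-1 : ℝ) * hquad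
        have := Real.sqrt_sq (norm_nonneg (q - σ • v₀))
        rw [h2, Real.sqrt_sq hσ0] at this
        exact this.symm
      rw [h0, hnorm]
      abel

/-- The Liénard–Wiechert distance at a retarded point: with `σ = ‖y − r‖`, `p = ⟪y − r, v₀⟫`,
`ρ(r − (y + σ v₀))² = (σ + p)²`. [folklore] -/
theorem lwDist_sq_retarded (y : E3) :
    (1 - ‖v₀‖ ^ 2) * ‖r - (y + ‖y - r‖ • v₀)‖ ^ 2 + ⟪v₀, r - (y + ‖y - r‖ • v₀)⟫ ^ 2 =
      (‖y - r‖ + ⟪y - r, v₀⟫) ^ 2 := by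
  have h1 : r - (y + ‖y - r‖ • v₀) = -((y - r) + ‖y - r‖ • v₀) := by abel
  rw [h1, norm_neg, inner_neg_right, neg_sq, norm_add_sq_real, inner_add_right, real_inner_smul_right,
    real_inner_smul_right, norm_smul, mul_pow, Real.norm_eq_abs, sq_abs, real_inner_self_eq_norm_sq,
    real_inner_comm (y - r) v₀]
  ring

/-- **The retarded change of variables**: for `‖v₀‖ < 1` and any `G`,
`∫ G(y′)/ρ(r − y′) dy′ = ∫ G(y + ‖y − r‖v₀)/‖y − r‖ dy`. [folklore] -/
theorem integral_div_lwDist_eq_retarded (hv : ‖v₀‖ < 1) (G : E3 → ℝ) :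
    ∫ y', G y' / Real.sqrt ((1 - ‖v₀‖ ^ 2) * ‖r - y'‖ ^ 2 + ⟪v₀, r - y'⟫ ^ 2) =
      ∫ y, G (y + ‖y - r‖ • v₀) / ‖y - r‖ := by
  set Ψ : E3 → E3 := fun y ↦ y + ‖y - r‖ • v₀ with hΨ
  set F : E3 → ℝ := fun y' ↦ G y' / Real.sqrt ((1 - ‖v₀‖ ^ 2) * ‖r - y'‖ ^ 2 + ⟪v₀, r - y'⟫ ^ 2)
    with hF
  -- derivative of `Ψ` off `r`
  have hderiv : ∀ y ∈ ({r}ᶜ : Set E3), HasFDerivWithinAt Ψ (ContinuousLinearMap.id ℝ E3 +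
      (innerSL ℝ ((‖y - r‖)⁻¹ • (y - r))).smulRight v₀) {r}ᶜ y := by
    intro y hy
    have hyr : y ≠ r := hy
    have h := (hasFDerivAt_id y).add ((hasFDerivAt_dist (x := r) hyr).smul_const v₀)
    rw [← map_smul] at h
    exact h.hasFDerivWithinAt
  have hcv := integral_image_eq_integral_abs_det_fderiv_smul volume
    (MeasurableSet.singleton r).compl hderiv (retardedMap_injective hv).injOn F
  rw [retardedMap_image_compl hv, MeasureTheory.restrict_compl_singleton] at hcv
  change ∫ y', F y' = _
  rw [hcv, ← MeasureTheory.restrict_compl_singleton (μ := (volume : Measure E3)) r]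
  refine setIntegral_congr_fun (MeasurableSet.singleton r).compl fun y hy ↦ ?_
  have hyr : y ≠ r := hy
  have hσ : 0 < ‖y - r‖ := norm_pos_iff.2 (sub_ne_zero.2 hyr)
  set σ : ℝ := ‖y - r‖ with hσdef
  set p : ℝ := ⟪y - r, v₀⟫ with hp
  have hpσ : |p| < σ := by
    calc |p| ≤ ‖y - r‖ * ‖v₀‖ := abs_real_inner_le_norm _ _
      _ < ‖y - r‖ * 1 := mul_lt_mul_of_pos_left hv hσ
      _ = σ := mul_one _
  have hσp : 0 < σ + p := by linarith [neg_abs_le p]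
  rw [det_id_add_smulRight, real_inner_smul_left, hF]
  simp only [hΨ]
  have hdet : 0 < 1 + σ⁻¹ * p := by
    have : 1 + σ⁻¹ * p = (σ + p) / σ := by field_simp
    rw [this]
    exact div_pos hσp hσ
  rw [lwDist_sq_retarded, Real.sqrt_sq hσp.le, ← hσdef, ← hp, smul_eq_mul, abs_of_pos hdet]
  field_simp

end Retarded

/-! ### The representation -/

/-- **The travelling profile is the retarded integral of the tangent motion.** A `C²` profile
`W → 0` at infinity with `D²W[v₀, v₀] − ΔW = 4πM φ` (`‖v₀‖ < 1`, `φ` continuous and supported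
in the unit ball) satisfies `W(r) = M ∫ φ(y + ‖y − r‖ v₀)/‖y − r‖ dy` at every `r`. [folklore] -/
theorem travelling_profile_eq_retarded_integral (hW : ContDiff ℝ 2 W)
    (hW0 : Tendsto W (cocompact E3) (𝓝 0)) (hφ0 : ∀ z : E3, 1 ≤ ‖z‖ → φ z = 0) (hv : ‖v₀‖ < 1)
    (hPDE : ∀ z, fderiv ℝ (fun q ↦ fderiv ℝ W q v₀) z v₀ - (Δ W) z = 4 * Real.pi * M * φ z)
    (r : E3) :
    W r = M * ∫ y, φ (y + ‖y - r‖ • v₀) / ‖y - r‖ := by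
  rw [eq_integral_div_lwDist hW hW0 hφ0 hv hPDE r, integral_div_lwDist_eq_retarded hv]

/-! ### Registered form -/

/-- **The travelling profile is the retarded integral of the tangent motion** (registered helper of
stmt-FinalStateConjecture-17402, brick `FarConeRetardationRemainder`). [folklore] -/
theorem farCone_travelling_profile_eq_retarded_integral : ∀ (W φ : EuclideanSpace ℝ (Fin 3) → ℝ) (v₀ : EuclideanSpace ℝ (Fin 3)) (M : ℝ), ContDiff ℝ 2 W → Filter.Tendsto W (Filter.cocompact (EuclideanSpace ℝ (Fin 3))) (nhds 0) → (∀ z, 1 ≤ ‖z‖ → φ z = 0) → ‖v₀‖ < 1 → (∀ z : EuclideanSpace ℝ (Fin 3), fderiv ℝ (fun q ↦ fderiv ℝ W q v₀) z v₀ - (Laplacian.laplacian W : EuclideanSpace ℝ (Fin 3) → ℝ) z = 4 * Real.pi * M * φ z) → ∀ r : EuclideanSpace ℝ (Fin 3), W r = M * MeasureTheory.integral MeasureTheory.volume (fun y : EuclideanSpace ℝ (Fin 3) ↦ φ (y + ‖y - r‖ • v₀) / ‖y - r‖) :=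
  fun _W _φ _v₀ _M hW hW0 hφ0 hv hPDE r ↦ travelling_profile_eq_retarded_integral hW hW0 hφ0 hv hPDE r

end Summit.FinalStateConjecture.FinalStateConjecture.Theorems.EIHFluxBalance.ModulatedKerrHandoffBricks.FarCone

end
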